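import Summits.HodgeConjecture.CorCM.Census.BlockParityBurnside
import Summits.HodgeConjecture.CorCM.Census.HalfParityBlocks

/-!
# The subgroup generated by the type stabilisers: `𝒦(G,c) = ⟨c, {g : c ∉ ⟨g⟩}⟩ = ⟨⋃_Ψ Stab⁺(Ψ)⟩`

COR-CM (cell `pub-hodgecm2`), count-neutral kernel combinatorics by the census seat lit-andre-3 (gen 19; lane
TYPE-STABILISER-SUBGROUP), the group-theoretic leaf reserved for this seat by the binder seat b09 (gen 31, CLOSED-FORM LAW) in the
abstract currency of `Census/BlockParityLaw.lean` (`CMF G c`, base change `rt`), `Census/BlockParityBurnside.lean` (fixed types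
of a base change) and `Census/HalfParityBlocks.lean` (`stab`).  Two bookkeeping `Subgroup` definitions with bodies (`stabPM`,
`stabGen`) + theorems; no `Prop`-valued definition, no `decide`, no certificate, no named fact, no `sorry`.
HONEST FRAMING: `HC_CM` is NOT proved, here or anywhere in the tree; nothing here is a period or a headline.

THE SETTING.  `G` a finite group, `c : G` a central involution (`c * c = 1`, `∀ x, x * c = c * x`; `c ≠ 1` where stated),
`CMF G c` the CM types `Ψ ⊆ G` (`G = Ψ ⊔ cΨ`), `rt c Q Ψ = Ψ·Q⁻¹` the base change, `stab c Ψ = {Q | Ψ·Q⁻¹ = Ψ}` the stabiliser,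
`Ψ̄ = Ψ·c` the conjugate type (`rt_self_val`).

CONTENT (LEMMA K of the closed form `φ₂(G,c) = β(G,c) + d₂(G/𝒦) − 1 − [|G|/2 even]` for the coinvariant fibre
`Census/CoinvariantFibre.fibreTwo`; this file is the definition of `𝒦` and its stabiliser description, nothing more).
* §1 **Which elements stabilise a type.**  `(∃ Ψ, Ψ·g⁻¹ = Ψ) ↔ c ∉ ⟨g⟩` (`exists_rt_eq_iff_notMem_zpowers`,
  `exists_mem_stab_iff_notMem_zpowers`): (⇒) is b09's `not_rt_eq_of_mem_zpowers` (`Ψ·c = Ψ̄ ≠ Ψ`), (⇐) is b09's count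
  `card_fixed_eq_pow` (the fixed types are the sections of `c·` on `G ⧸ ⟨g⟩`, `2^{|G|/ord g/2} ≥ 1` of them).  In particular
  `c ∉ stab Ψ` (`self_notMem_stab`) and every element of a stabiliser misses `c` in its cyclic group (`notMem_zpowers_of_mem_stab`).
* §2 **The stabiliser up to conjugation** `stabPM c Ψ = Stab⁺(Ψ) = {Q | Ψ·Q⁻¹ ∈ {Ψ, Ψ̄}}` (`mem_stabPM_iff`), `= stab Ψ ⊔ c·stab Ψ`
  in the form `Q ∈ Stab⁺(Ψ) ↔ Q ∈ stab Ψ ∨ Q·c ∈ stab Ψ` (`mem_stabPM_iff_mem_stab`); `c ∈ Stab⁺(Ψ)`, `stab Ψ ≤ Stab⁺(Ψ)`.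
* §0/§3 **The subgroup `𝒦`.**  `stabGen c := closure ({c} ∪ {g | c ∉ ⟨g⟩})` (§0, pure group theory).  THEOREMS (§3): `stab Ψ ≤ 𝒦`, `Stab⁺(Ψ) ≤ 𝒦`;
  **`𝒦 ≤ H ↔ c ∈ H ∧ ∀ Ψ, stab Ψ ≤ H`** (`stabGen_le_iff`) and `𝒦 ≤ H ↔ ∀ Ψ, Stab⁺(Ψ) ≤ H` (`stabGen_le_iff_forall_stabPM_le`),
  so that b09's «index-two `H ∋ c` containing every `Stab⁺(Ψ)`» reads `H.index = 2 ∧ stabGen c ≤ H`; the pointwise reading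
  `(∀ Ψ, stab Ψ ≤ H) ↔ ∀ g ∉ H, c ∈ ⟨g⟩` (`forall_stab_le_iff`); **`𝒦 = ⨆_Ψ Stab⁺(Ψ)`** (`stabGen_eq_iSup_stabPM`); `𝒦` is
  NORMAL (`stabGen_normal`; the generating set is conjugation-invariant); `𝒦` contains every element of odd order and every
  involution (`mem_stabGen_of_odd_orderOf`, `mem_stabGen_of_mul_self_eq_one`); and **`𝒦 = G` when `c` has a complement**
  (`stabGen_eq_top_of_cpl`, the situation of b09's `Census/CoinvariantComplement*`: `∀ x, x ∈ A ↔ c·x ∉ A`).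
EXAMPLES (worked in the lane memo `HOME/pub-hodgecm2-lit-andre-3/PORTFOLIO-lit-andre-3-g19.md`; no instance is decided here):
`𝒦 = G` for every complemented `c` (`stabGen_eq_top_of_cpl`) and for every `G` generated by involutions and elements of odd order
(all dihedral groups, `SL(2,3)`); `𝒦(ℤ/2m, m) = ⟨2^e⟩` for `m = 2^e·m'`, `m'` odd, so `G/𝒦 ≅ ℤ/2^e`; `𝒦(Q₈, −1) = 𝒦(Q₁₆, a⁴) = ⟨c⟩`
(`G/𝒦 ≅ (ℤ/2)²`, resp. `D₄`); `𝒦(Dic₃, a³) = ⟨c, a²⟩ ≅ ℤ/6` (`G/𝒦 ≅ ℤ/2`).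

## References
* [Pohlmann1968] H. Pohlmann, Algebraic cycles on abelian varieties of complex multiplication type, Ann. of Math. 88 (1968), Thm 1.
* [Milne1999] J. S. Milne, Lefschetz motives and the Tate conjecture, Compositio Math. 117 (1999), Prop. 2.1, p. 54.
-/

namespace Summit.HodgeConjecture.CorCM.Census.TypeStabiliser

open Finset
open Summit.HodgeConjecture.CorCM.Prior.AllgGroup.RfwfAllgGroup
open Summit.HodgeConjecture.CorCM.Census.BlockParity
open Summit.HodgeConjecture.CorCM.Census.HalfParity

noncomputable section

/-! ## §0 The subgroup `𝒦(G,c)` — pure group theory (no CM types yet) -/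

section GroupOnly

variable {G : Type*} [Group G] (c : G)

/-- **The subgroup `𝒦(G,c) = ⟨c, {g | c ∉ ⟨g⟩}⟩`** generated by `c` and the elements whose cyclic group misses `c`
(= the subgroup generated by all type stabilisers up to conjugation, `stabGen_eq_iSup_stabPM`). [folklore] -/
def stabGen : Subgroup G :=
  Subgroup.closure ({c} ∪ {g : G | c ∉ Subgroup.zpowers g})

/-- `c ∈ 𝒦`. [folklore] -/
theorem self_mem_stabGen : c ∈ stabGen c :=
  Subgroup.subset_closure (Or.inl rfl)

/-- `c ∉ ⟨g⟩ ⇒ g ∈ 𝒦`. [folklore] -/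
theorem mem_stabGen_of_notMem_zpowers {g : G} (hg : c ∉ Subgroup.zpowers g) : g ∈ stabGen c :=
  Subgroup.subset_closure (Or.inr hg)

/-- The universal property of `𝒦`: `𝒦 ≤ H ↔ c ∈ H ∧ {g | c ∉ ⟨g⟩} ⊆ H`. [folklore] -/
theorem stabGen_le_iff_subset {H : Subgroup G} :
    stabGen c ≤ H ↔ c ∈ H ∧ ∀ g : G, c ∉ Subgroup.zpowers g → g ∈ H := by
  rw [stabGen, Subgroup.closure_le]
  constructor
  · intro h
    exact ⟨h (Or.inl rfl), fun g hg => h (Or.inr hg)⟩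
  · rintro ⟨hc, hg⟩ x hx
    rcases hx with hx | hx
    · rw [Set.mem_singleton_iff] at hx
      rw [hx]
      exact hc
    · exact hg x hx

/-- `c ∈ ⟨h g h⁻¹⟩ ↔ c ∈ ⟨g⟩` for central `c`. [folklore] -/
theorem mem_zpowers_conj_iff (hcen : ∀ x : G, x * c = c * x) (h g : G) :
    c ∈ Subgroup.zpowers (h * g * h⁻¹) ↔ c ∈ Subgroup.zpowers g := by
  have key : ∀ (h g : G), c ∈ Subgroup.zpowers g → c ∈ Subgroup.zpowers (h * g * h⁻¹) := by
    intro h g hg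
    obtain ⟨k, hk⟩ := Subgroup.mem_zpowers_iff.mp hg
    refine Subgroup.mem_zpowers_iff.mpr ⟨k, ?_⟩
    rw [conj_zpow, hk, hcen h, mul_inv_cancel_right]
  refine ⟨fun hc => ?_, key h g⟩
  have e : h⁻¹ * (h * g * h⁻¹) * h⁻¹⁻¹ = g := by group
  rw [← e]
  exact key h⁻¹ _ hc

/-- **`𝒦` is a normal subgroup** (its generating set is invariant under conjugation, `c` being central). [folklore] -/
theorem stabGen_normal (hcen : ∀ x : G, x * c = c * x) : (stabGen c).Normal := by
  have hsub : Group.conjugatesOfSet ({c} ∪ {g : G | c ∉ Subgroup.zpowers g}) ⊆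
      ({c} ∪ {g : G | c ∉ Subgroup.zpowers g}) := by
    intro x hx
    obtain ⟨a, ha, hax⟩ := Group.mem_conjugatesOfSet_iff.mp hx
    obtain ⟨h, rfl⟩ := isConj_iff.mp hax
    rcases ha with ha | ha
    · rw [Set.mem_singleton_iff] at ha
      subst ha
      left
      rw [Set.mem_singleton_iff, hcen h, mul_inv_cancel_right]
    · right
      change c ∉ Subgroup.zpowers (h * a * h⁻¹)
      rw [mem_zpowers_conj_iff c hcen]
      exact ha
  have heq : stabGen c = Subgroup.normalClosure ({c} ∪ {g : G | c ∉ Subgroup.zpowers g}) :=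
    le_antisymm Subgroup.closure_le_normalClosure (Subgroup.closure_mono hsub)
  rw [heq]
  infer_instance

/-- The order of an involution `≠ 1` is `2`. [folklore] -/
theorem orderOf_eq_two_of_mul_self {g : G} (hg : g * g = 1) (hg1 : g ≠ 1) : orderOf g = 2 :=
  orderOf_eq_prime (by rw [pow_two]; exact hg) hg1

/-- `c ∉ ⟨g⟩` when `g` has odd order (`c` an involution `≠ 1`). [folklore] -/
theorem notMem_zpowers_of_odd_orderOf (hc2 : c * c = 1) (hc1 : c ≠ 1) {g : G} (hodd : Odd (orderOf g)) :
    c ∉ Subgroup.zpowers g := by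
  intro h
  have hdvd := orderOf_dvd_of_mem_zpowers h
  rw [orderOf_eq_two_of_mul_self hc2 hc1] at hdvd
  exact hodd.not_two_dvd_nat hdvd

/-- **Elements of odd order lie in `𝒦`.** [folklore] -/
theorem mem_stabGen_of_odd_orderOf (hc2 : c * c = 1) (hc1 : c ≠ 1) {g : G} (hodd : Odd (orderOf g)) :
    g ∈ stabGen c :=
  mem_stabGen_of_notMem_zpowers c (notMem_zpowers_of_odd_orderOf c hc2 hc1 hodd)

/-- `c ∉ ⟨g⟩` for an involution `g ≠ c` when `c ≠ 1` (`⟨g⟩ = {1, g}`). [folklore] -/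
theorem notMem_zpowers_of_mul_self_eq_one {g : G} (hg : g * g = 1) (hc1 : c ≠ 1) (hgc : g ≠ c) :
    c ∉ Subgroup.zpowers g := by
  intro hx
  obtain ⟨k, hk⟩ := Subgroup.mem_zpowers_iff.mp hx
  have h2 : g ^ (2 : ℤ) = 1 := by rw [zpow_two]; exact hg
  obtain ⟨j, hj | hj⟩ := Int.even_or_odd' k
  · rw [hj, zpow_mul, h2, one_zpow] at hk
    exact hc1 hk.symm
  · rw [hj, zpow_add, zpow_mul, h2, one_zpow, one_mul, zpow_one] at hk
    exact hgc hk

/-- **Involutions lie in `𝒦`** (`c` itself, and every other involution `g`, since then `⟨g⟩ = {1, g} ∌ c`). [folklore] -/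
theorem mem_stabGen_of_mul_self_eq_one (hc1 : c ≠ 1) {g : G} (hg : g * g = 1) : g ∈ stabGen c := by
  by_cases hgc : g = c
  · rw [hgc]; exact self_mem_stabGen c
  · exact mem_stabGen_of_notMem_zpowers c (notMem_zpowers_of_mul_self_eq_one c hg hc1 hgc)

/-- **`𝒦 = G` when `c` has a complement** `A` (`∀ x, x ∈ A ↔ c·x ∉ A`, the situation of `Census/CoinvariantComplement*`):
every `a ∈ A` has `⟨a⟩ ≤ A ∌ c`, and `G = A ⊔ cA`. [folklore] -/
theorem stabGen_eq_top_of_cpl (hc2 : c * c = 1) {A : Subgroup G} (hA : ∀ x : G, x ∈ A ↔ c * x ∉ A) :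
    stabGen c = ⊤ := by
  have hcA : c ∉ A := by
    have h1 := (hA 1).mp A.one_mem
    rwa [mul_one] at h1
  have hAK : A ≤ stabGen c := fun a ha =>
    mem_stabGen_of_notMem_zpowers c fun h => hcA (Subgroup.zpowers_le.mpr ha h)
  rw [eq_top_iff]
  intro x _
  by_cases hx : x ∈ A
  · exact hAK hx
  · have hcx : c * x ∈ A := (hA (c * x)).mpr (by rwa [cmul_cmul c hc2 x])
    have h := (stabGen c).mul_mem (self_mem_stabGen c) (hAK hcx)
    rwa [cmul_cmul c hc2 x] at h

end GroupOnly

/-! ## §1 Which elements stabilise a type (Lemma K (i)) -/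

section Types

variable {G : Type*} [Group G] [Fintype G] [DecidableEq G] (c : G)

/-- **Existence of a fixed type**: if `c ∉ ⟨g⟩` (`c` a central involution) some CM type is fixed by the base change along `g`
— there are `2^{|G|/ord g/2} ≥ 1` of them (`card_fixed_eq_pow`: the sections of `c·` on `G ⧸ ⟨g⟩`). [folklore] -/
theorem exists_rt_eq_of_notMem_zpowers (hc2 : c * c = 1) (hcen : ∀ x : G, x * c = c * x) {g : G}
    (hg : c ∉ Subgroup.zpowers g) : ∃ Ψ : CMF G c, rt c g Ψ = Ψ := by
  have hpos : 0 < Nat.card {Ψ : CMF G c // rt c g Ψ = Ψ} := by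
    rw [card_fixed_eq_pow c hc2 hcen hg]
    positivity
  obtain ⟨⟨Ψ, hΨ⟩⟩ := (Nat.card_pos_iff.mp hpos).1
  exact ⟨Ψ, hΨ⟩

/-- **LEMMA K (i).**  `(∃ Ψ, Ψ·g⁻¹ = Ψ) ↔ c ∉ ⟨g⟩` for a central involution `c`: a `g`-fixed type is a union of left cosets
`x⟨g⟩` containing no pair `{x, cx}`, impossible if `c ∈ ⟨g⟩` (`not_rt_eq_of_mem_zpowers`); conversely choose one coset from each
pair `{x⟨g⟩, cx⟨g⟩}`. [folklore] -/
theorem exists_rt_eq_iff_notMem_zpowers (hc2 : c * c = 1) (hcen : ∀ x : G, x * c = c * x) (g : G) :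
    (∃ Ψ : CMF G c, rt c g Ψ = Ψ) ↔ c ∉ Subgroup.zpowers g :=
  ⟨fun ⟨Ψ, hΨ⟩ hg => not_rt_eq_of_mem_zpowers c hcen hg Ψ hΨ, exists_rt_eq_of_notMem_zpowers c hc2 hcen⟩

/-- Lemma K (i) in the `stab` currency: `(∃ Ψ, g ∈ stab Ψ) ↔ c ∉ ⟨g⟩`. [folklore] -/
theorem exists_mem_stab_iff_notMem_zpowers (hc2 : c * c = 1) (hcen : ∀ x : G, x * c = c * x) (g : G) :
    (∃ Ψ : CMF G c, g ∈ stab c Ψ) ↔ c ∉ Subgroup.zpowers g :=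
  exists_rt_eq_iff_notMem_zpowers c hc2 hcen g

/-- Every element of a type stabiliser misses `c` in its cyclic group. [folklore] -/
theorem notMem_zpowers_of_mem_stab (hcen : ∀ x : G, x * c = c * x) {g : G} {Ψ : CMF G c} (h : g ∈ stab c Ψ) :
    c ∉ Subgroup.zpowers g :=
  fun hg => not_rt_eq_of_mem_zpowers c hcen hg Ψ h

/-- `c` stabilises no type (`Ψ·c = Ψ̄`). [folklore] -/
theorem self_notMem_stab (hcen : ∀ x : G, x * c = c * x) (Ψ : CMF G c) : c ∉ stab c Ψ :=
  fun h => not_rt_eq_of_mem_zpowers c hcen (Subgroup.mem_zpowers c) Ψ h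

/-- **An involution other than `1` and `c` fixes some type** (`⟨g⟩ = {1, g} ∌ c`) — the step of the parity obstruction (E2) of
the closed-form law where Cauchy's involution in `ker κ` is moved off `c`. [folklore] -/
theorem exists_rt_eq_of_mul_self_eq_one (hc2 : c * c = 1) (hcen : ∀ x : G, x * c = c * x) (hc1 : c ≠ 1) {g : G}
    (hg : g * g = 1) (hgc : g ≠ c) : ∃ Ψ : CMF G c, rt c g Ψ = Ψ :=
  exists_rt_eq_of_notMem_zpowers c hc2 hcen (notMem_zpowers_of_mul_self_eq_one c hg hc1 hgc)

/-! ## §2 The stabiliser up to conjugation `Stab⁺(Ψ)` (Lemma K (ii)) -/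

/-- Base changes along `Q` and along the central `c` commute. [folklore] -/
theorem rt_rt_self_comm (hcen : ∀ x : G, x * c = c * x) (Q : G) (Ψ : CMF G c) :
    rt c Q (rt c c Ψ) = rt c c (rt c Q Ψ) := by
  rw [← rt_mul, ← rt_mul, hcen Q]

/-- `Ψ̄̄ = Ψ`: the base change along `c` is an involution. [folklore] -/
theorem rt_self_rt_self (hc2 : c * c = 1) (Ψ : CMF G c) : rt c c (rt c c Ψ) = Ψ := by
  rw [← rt_mul, hc2, rt_one]

/-- `Ψ·Q⁻¹ = Ψ̄ ↔ Q·c ∈ stab Ψ`. [folklore] -/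
theorem rt_eq_rt_self_iff (hc2 : c * c = 1) (hcen : ∀ x : G, x * c = c * x) (Q : G) (Ψ : CMF G c) :
    rt c Q Ψ = rt c c Ψ ↔ Q * c ∈ stab c Ψ := by
  rw [mem_stab, rt_mul]
  constructor
  · intro h
    rw [rt_rt_self_comm c hcen, h, rt_self_rt_self c hc2]
  · intro h
    conv_lhs => rw [← rt_self_rt_self c hc2 Ψ]
    rw [rt_rt_self_comm c hcen, h]

/-- **`Stab⁺(Ψ)`**, the stabiliser of a type UP TO CONJUGATION: the subgroup generated by `{Q | Ψ·Q⁻¹ ∈ {Ψ, Ψ̄}}` — which IS that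
set for a central involution `c` (`mem_stabPM_iff`). [folklore] -/
def stabPM (Ψ : CMF G c) : Subgroup G :=
  Subgroup.closure {Q : G | rt c Q Ψ = Ψ ∨ rt c Q Ψ = rt c c Ψ}

/-- **Membership in `Stab⁺(Ψ)`**: `Q ∈ Stab⁺(Ψ) ↔ Ψ·Q⁻¹ = Ψ ∨ Ψ·Q⁻¹ = Ψ̄` (`c` a central involution). [folklore] -/
theorem mem_stabPM_iff (hc2 : c * c = 1) (hcen : ∀ x : G, x * c = c * x) (Ψ : CMF G c) (Q : G) :
    Q ∈ stabPM c Ψ ↔ rt c Q Ψ = Ψ ∨ rt c Q Ψ = rt c c Ψ := by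
  constructor
  · intro hQ
    refine Subgroup.closure_induction (fun x hx => hx) ?_ (fun x y _ _ ihx ihy => ?_) (fun x _ ihx => ?_) hQ
    · exact Or.inl (rt_one c Ψ)
    · rw [rt_mul]
      rcases ihy with hy | hy <;> rw [hy]
      · exact ihx
      · rw [rt_rt_self_comm c hcen]
        rcases ihx with hx | hx <;> rw [hx]
        · exact Or.inr rfl
        · exact Or.inl (rt_self_rt_self c hc2 Ψ)
    · rcases ihx with hx | hx
      · left
        conv_lhs => rw [← hx]
        rw [rt_inv_rt]
      · right
        have e : rt c x⁻¹ (rt c x Ψ) = Ψ := rt_inv_rt c x Ψ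
        rw [hx, rt_rt_self_comm c hcen] at e
        have e' := congrArg (rt c c) e
        rwa [rt_self_rt_self c hc2] at e'
  · intro hQ
    exact Subgroup.subset_closure hQ

/-- **LEMMA K (ii)**: `Stab⁺(Ψ) = stab Ψ ⊔ (stab Ψ)·c`, i.e. `Q ∈ Stab⁺(Ψ) ↔ Q ∈ stab Ψ ∨ Q·c ∈ stab Ψ`. [folklore] -/
theorem mem_stabPM_iff_mem_stab (hc2 : c * c = 1) (hcen : ∀ x : G, x * c = c * x) (Ψ : CMF G c) (Q : G) :
    Q ∈ stabPM c Ψ ↔ Q ∈ stab c Ψ ∨ Q * c ∈ stab c Ψ := by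
  simp only [mem_stabPM_iff c hc2 hcen, rt_eq_rt_self_iff c hc2 hcen, mem_stab]

/-- `stab Ψ ≤ Stab⁺(Ψ)`. [folklore] -/
theorem stab_le_stabPM (Ψ : CMF G c) : stab c Ψ ≤ stabPM c Ψ :=
  fun _ hQ => Subgroup.subset_closure (Or.inl hQ)

/-- `c ∈ Stab⁺(Ψ)` (`Ψ·c⁻¹ = Ψ̄`). [folklore] -/
theorem self_mem_stabPM (Ψ : CMF G c) : c ∈ stabPM c Ψ :=
  Subgroup.subset_closure (Or.inr rfl)

/-- `Stab⁺(Ψ) = stab Ψ ⊔ ⟨c⟩`. [folklore] -/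
theorem stabPM_eq_sup (hc2 : c * c = 1) (hcen : ∀ x : G, x * c = c * x) (Ψ : CMF G c) :
    stabPM c Ψ = stab c Ψ ⊔ Subgroup.zpowers c := by
  apply le_antisymm
  · intro Q hQ
    rcases (mem_stabPM_iff_mem_stab c hc2 hcen Ψ Q).mp hQ with h | h
    · exact Subgroup.mem_sup_left h
    · have hc : c ∈ stab c Ψ ⊔ Subgroup.zpowers c := Subgroup.mem_sup_right (Subgroup.mem_zpowers c)
      exact (Subgroup.mul_mem_cancel_right _ hc).mp (Subgroup.mem_sup_left h)
  · exact sup_le (stab_le_stabPM c Ψ) (Subgroup.zpowers_le.mpr (self_mem_stabPM c Ψ))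

/-- … and the two pieces meet trivially: `stab Ψ ⊓ ⟨c⟩ = ⊥` (`⟨c⟩ = {1, c}`, `c ∉ stab Ψ`), so `Stab⁺(Ψ) ≅ stab Ψ × ⟨c⟩`.
[folklore] -/
theorem stab_inf_zpowers_eq_bot (hc2 : c * c = 1) (hcen : ∀ x : G, x * c = c * x) (Ψ : CMF G c) :
    stab c Ψ ⊓ Subgroup.zpowers c = ⊥ := by
  rw [eq_bot_iff]
  intro x hx
  rw [Subgroup.mem_bot]
  obtain ⟨hxs, hxz⟩ := Subgroup.mem_inf.mp hx
  by_contra hx1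
  have hxc : x ≠ c := fun h => self_notMem_stab c hcen Ψ (h ▸ hxs)
  exact notMem_zpowers_of_mul_self_eq_one x hc2 hx1 (Ne.symm hxc) hxz

/-- **`Stab⁺` along a block is conjugate**: `Q ∈ Stab⁺(Ψ·P⁻¹) ↔ P⁻¹ Q P ∈ Stab⁺(Ψ)` (cf. `mem_stab_rt_iff`). [folklore] -/
theorem mem_stabPM_rt_iff (hc2 : c * c = 1) (hcen : ∀ x : G, x * c = c * x) (Ψ : CMF G c) (P Q : G) :
    Q ∈ stabPM c (rt c P Ψ) ↔ P⁻¹ * Q * P ∈ stabPM c Ψ := by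
  rw [mem_stabPM_iff_mem_stab c hc2 hcen, mem_stabPM_iff_mem_stab c hc2 hcen, mem_stab_rt_iff, mem_stab_rt_iff]
  have e : P⁻¹ * (Q * c) * P = P⁻¹ * Q * P * c := by
    simp only [mul_assoc, hcen P]
  rw [e]

/-! ## §3 `𝒦` is generated by the stabilisers (Lemma K (iii)) -/

/-- Every type stabiliser lies in `𝒦`. [folklore] -/
theorem stab_le_stabGen (hcen : ∀ x : G, x * c = c * x) (Ψ : CMF G c) : stab c Ψ ≤ stabGen c :=
  fun _ hg => mem_stabGen_of_notMem_zpowers c (notMem_zpowers_of_mem_stab c hcen hg)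

/-- Every `Stab⁺(Ψ)` lies in `𝒦`. [folklore] -/
theorem stabPM_le_stabGen (hc2 : c * c = 1) (hcen : ∀ x : G, x * c = c * x) (Ψ : CMF G c) :
    stabPM c Ψ ≤ stabGen c := by
  intro Q hQ
  rcases (mem_stabPM_iff_mem_stab c hc2 hcen Ψ Q).mp hQ with h | h
  · exact stab_le_stabGen c hcen Ψ h
  · exact (Subgroup.mul_mem_cancel_right (stabGen c) (self_mem_stabGen c)).mp (stab_le_stabGen c hcen Ψ h)

/-- **THE UNIVERSAL PROPERTY OF `𝒦` IN THE STABILISER CURRENCY**: `𝒦 ≤ H ↔ c ∈ H ∧ ∀ Ψ, stab Ψ ≤ H`.  So b09's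
«index-two `H ∋ c` containing every `Stab⁺(Ψ)`» is exactly `H.index = 2 ∧ stabGen c ≤ H`. [folklore] -/
theorem stabGen_le_iff (hc2 : c * c = 1) (hcen : ∀ x : G, x * c = c * x) {H : Subgroup G} :
    stabGen c ≤ H ↔ c ∈ H ∧ ∀ Ψ : CMF G c, stab c Ψ ≤ H := by
  rw [stabGen_le_iff_subset]
  refine and_congr_right fun _ => ⟨fun h Ψ => ?_, fun h g hg => ?_⟩
  · exact fun g hg => h g (notMem_zpowers_of_mem_stab c hcen hg)
  · obtain ⟨Ψ, hΨ⟩ := exists_rt_eq_of_notMem_zpowers c hc2 hcen hg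
    exact h Ψ hΨ

/-- The same with `Stab⁺`: `𝒦 ≤ H ↔ ∀ Ψ, Stab⁺(Ψ) ≤ H` (`c ≠ 1`, so that at least one type exists). [folklore] -/
theorem stabGen_le_iff_forall_stabPM_le (hc2 : c * c = 1) (hcen : ∀ x : G, x * c = c * x) (hc1 : c ≠ 1)
    {H : Subgroup G} : stabGen c ≤ H ↔ ∀ Ψ : CMF G c, stabPM c Ψ ≤ H := by
  constructor
  · intro h Ψ
    exact (stabPM_le_stabGen c hc2 hcen Ψ).trans h
  · intro h
    obtain ⟨Φ, hΦ⟩ := exists_isCMF c hc2 hc1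
    refine (stabGen_le_iff c hc2 hcen).mpr ⟨h ⟨Φ, hΦ⟩ (self_mem_stabPM c ⟨Φ, hΦ⟩), fun Ψ => ?_⟩
    exact (stab_le_stabPM c Ψ).trans (h Ψ)

/-- The pointwise reading of «every stabiliser lies in `H`»: `(∀ Ψ, stab Ψ ≤ H) ↔ ∀ g ∉ H, c ∈ ⟨g⟩`. [folklore] -/
theorem forall_stab_le_iff (hc2 : c * c = 1) (hcen : ∀ x : G, x * c = c * x) {H : Subgroup G} :
    (∀ Ψ : CMF G c, stab c Ψ ≤ H) ↔ ∀ g : G, g ∉ H → c ∈ Subgroup.zpowers g := by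
  constructor
  · intro h g hg
    by_contra hc
    obtain ⟨Ψ, hΨ⟩ := exists_rt_eq_of_notMem_zpowers c hc2 hcen hc
    exact hg (h Ψ hΨ)
  · intro h Ψ g hg
    by_contra hgH
    exact notMem_zpowers_of_mem_stab c hcen hg (h g hgH)

/-- **LEMMA K (iii): `𝒦 = ⨆_Ψ Stab⁺(Ψ)`** — the subgroup generated by all stabilisers up to conjugation is
`⟨c, {g | c ∉ ⟨g⟩}⟩` (`c` a central involution `≠ 1`). [folklore] -/
theorem stabGen_eq_iSup_stabPM (hc2 : c * c = 1) (hcen : ∀ x : G, x * c = c * x) (hc1 : c ≠ 1) :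
    stabGen c = ⨆ Ψ : CMF G c, stabPM c Ψ :=
  le_antisymm ((stabGen_le_iff_forall_stabPM_le c hc2 hcen hc1).mpr fun Ψ => le_iSup (fun Ψ => stabPM c Ψ) Ψ)
    (iSup_le fun Ψ => stabPM_le_stabGen c hc2 hcen Ψ)

/-- The closure form: `𝒦 = ⟨{c} ∪ ⋃_Ψ stab Ψ⟩`. [folklore] -/
theorem stabGen_eq_closure_stab (hc2 : c * c = 1) (hcen : ∀ x : G, x * c = c * x) :
    stabGen c = Subgroup.closure ({c} ∪ ⋃ Ψ : CMF G c, (stab c Ψ : Set G)) := by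
  apply le_antisymm
  · rw [stabGen_le_iff c hc2 hcen]
    refine ⟨Subgroup.subset_closure (Or.inl rfl), fun Ψ g hg => Subgroup.subset_closure (Or.inr ?_)⟩
    exact Set.mem_iUnion.mpr ⟨Ψ, hg⟩
  · rw [Subgroup.closure_le]
    rintro g (hg | hg)
    · rw [Set.mem_singleton_iff] at hg
      rw [hg]
      exact self_mem_stabGen c
    · obtain ⟨Ψ, hΨ⟩ := Set.mem_iUnion.mp hg
      exact stab_le_stabGen c hcen Ψ hΨ

/-- **An index-two subgroup over `𝒦` splits every block into two halves**: if `stabGen c ≤ H` then every type has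
`stab Ψ ≤ H` — the admissibility hypothesis of b09's half-block sets (`HalfParityBlocks.horb_disjoint`, `halfOf`). [folklore] -/
theorem stab_le_of_stabGen_le (hcen : ∀ x : G, x * c = c * x) {H : Subgroup G} (h : stabGen c ≤ H) (Ψ : CMF G c) :
    stab c Ψ ≤ H :=
  (stab_le_stabGen c hcen Ψ).trans h

end Types

end

end Summit.HodgeConjecture.CorCM.Census.TypeStabiliser
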